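import Summits.HodgeConjecture.CorCM.Census.MultiFieldWeilDefect
import Mathlib.RingTheory.Polynomial.Cyclotomic.Roots
import Mathlib.RingTheory.RootsOfUnity.Complex
import HarnessLib

/-!
# MULTI-FIELD WEIL, census part 5: PRIME ROTATIONS SEPARATE — translate sums of a function on `ℤ/ℓ` (`ℓ` prime) through a proper non-empty subset that do
# not depend on the translate force a constant function (Gauss: the `ℓ`-th cyclotomic polynomial is irreducible)

COR-CM (cell `pub-hodgecm2`), seat b30 gen 29 (2026-08-24); count-neutral own lane MULTI-FIELD WEIL ENGINE (stem `MultiFieldWeil*`).  Pure algebra (Mathlib cyclotomic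
polynomials); no definition, no named fact, no geometry, no `sorry`, no `decide`.  The general-prime form of gen 27ʼs five-point lemma `SexticDecicWeil.const_of_pairSums`
(`ℓ = 5`, `|P| = 2`), which is what peels a slot of PRIME relative degree `ℓ` by a realised `ℓ`-cycle in every instance of the engine (decic slots so far; tetradecic,
`ℓ = 7`, and beyond from here).

THE ARGUMENT.  `ζ = e^{2πi/ℓ}`.  For `u : ℤ/ℓ → ℤ` with `Σ_{x ∈ P} u(x + j)` independent of `j`: multiplying by `ζ^j` and summing over `j` gives
`(Σ_{x ∈ P} ζ^{−x}) · (Σ_y u(y) ζ^y) = (Σ_x u x)·(Σ_j ζ^j) = 0`.  A sum of `|P|` distinct `ℓ`-th roots of unity with `0 < |P| < ℓ` is NON-ZERO, and `Σ_y u(y) ζ^y = 0` forces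
`u` constant — both by ONE lemma (**`coeff_eq_of_aeval_eq_zero`**): a rational polynomial of degree `< ℓ` vanishing at `ζ` has ALL its coefficients `0, …, ℓ−1` EQUAL (it is a
multiple of the minimal polynomial `Φ_ℓ = 1 + X + ⋯ + X^{ℓ−1}` of `ζ`, of the same degree).  Results: **`sum_pow_ne_zero_of_card_lt`**, **`const_of_translate_sums`**.
[cite: DixonMortimer1996, §2.1] [cite: GaoUllmo2025, Thm 3.1]

## References
* [DixonMortimer1996] J. D. Dixon, B. Mortimer, *Permutation Groups*, GTM 163, §2.1.  [GaoUllmo2025] Z. Gao, E. Ullmo, J. Inst. Math. Jussieu 25 (2025), Thm 3.1.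
-/

namespace Summit.HodgeConjecture.CorCM.Census.MultiFieldWeil

open Finset Polynomial

section Cyclotomic

variable {ℓ : ℕ} [hℓ : Fact ℓ.Prime]

omit hℓ in
/-- The coefficients of `Σ_y w(y) X^y` (`y < ℓ`). [folklore] -/
theorem coeff_sum_C_mul_X_pow (w : Fin ℓ → ℚ) (i : ℕ) :
    (∑ y : Fin ℓ, C (w y) * X ^ (y : ℕ)).coeff i = if hi : i < ℓ then w ⟨i, hi⟩ else 0 := by
  rw [finsetSum_coeff]
  simp_rw [coeff_C_mul_X_pow]
  split_ifs with hi
  · rw [Finset.sum_eq_single_of_mem (⟨i, hi⟩ : Fin ℓ) (Finset.mem_univ _) fun y _ hy => if_neg fun h => hy (Fin.ext h.symm)]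
    exact if_pos rfl
  · exact Finset.sum_eq_zero fun y _ => if_neg fun h : i = (y : ℕ) => hi (by omega)

/-- **A rational polynomial of degree `< ℓ` vanishing at a primitive `ℓ`-th root of unity has all its coefficients `0, …, ℓ − 1` equal** (`ℓ` prime): it is a rational
multiple of `Φ_ℓ = Σ_{i<ℓ} X^i`, the minimal polynomial of `ζ` (Gauss), which has the same degree `ℓ − 1`. [folklore] -/
theorem coeff_eq_of_aeval_eq_zero {ζ : ℂ} (hζ : IsPrimitiveRoot ζ ℓ) {G : ℚ[X]} (hG : ∀ i, ℓ ≤ i → G.coeff i = 0) (hroot : aeval ζ G = 0)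
    (i : ℕ) (hi : i < ℓ) : G.coeff i = G.coeff (ℓ - 1) := by
  have hℓp : ℓ.Prime := hℓ.out
  set c : ℚ := G.coeff (ℓ - 1) with hc
  have hcoeff_cyc : ∀ j, (cyclotomic ℓ ℚ).coeff j = if j < ℓ then 1 else 0 := by
    intro j
    rw [cyclotomic_prime ℚ ℓ, finsetSum_coeff]
    simp only [coeff_X_pow, Finset.sum_ite_eq, Finset.mem_range]
  -- `G' = G − c Φ_ℓ` vanishes at `ζ` and has degree `< ℓ − 1`
  set G' : ℚ[X] := G - C c * cyclotomic ℓ ℚ with hG'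
  have hroot' : aeval ζ G' = 0 := by
    have hcyc0 : aeval ζ (cyclotomic ℓ ℚ) = 0 := by
      rw [cyclotomic_eq_minpoly_rat hζ hℓp.pos]
      exact minpoly.aeval ℚ ζ
    rw [hG', map_sub, map_mul, hroot, hcyc0, mul_zero, sub_zero]
  have hcoeff' : ∀ j, G'.coeff j = G.coeff j - c * (if j < ℓ then 1 else 0) := by
    intro j
    rw [hG', coeff_sub, coeff_C_mul, hcoeff_cyc]
  have hdeg' : G'.degree < ((ℓ - 1 : ℕ) : WithBot ℕ) := by
    rw [degree_lt_iff_coeff_zero]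
    intro j hj
    rw [hcoeff']
    by_cases hjℓ : j < ℓ
    · have hj' : j = ℓ - 1 := by omega
      rw [if_pos hjℓ, mul_one, hj', ← hc, sub_self]
    · rw [if_neg hjℓ, mul_zero, sub_zero]
      exact hG j (by omega)
  have hG'0 : G' = 0 := by
    by_contra hne
    have h1 := minpoly.degree_le_of_ne_zero ℚ ζ hne hroot'
    rw [← cyclotomic_eq_minpoly_rat hζ hℓp.pos, degree_cyclotomic, Nat.totient_prime hℓp] at h1
    exact absurd (h1.trans_lt hdeg') (lt_irrefl _)
  have h := hcoeff' i
  rw [hG'0, coeff_zero, if_pos hi, mul_one] at h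
  linarith

omit hℓ in
/-- The value at `ζ` of `Σ_y w(y) X^y`. [folklore] -/
theorem aeval_sum_C_mul_X_pow (ζ : ℂ) (w : Fin ℓ → ℚ) :
    aeval ζ (∑ y : Fin ℓ, C (w y) * X ^ (y : ℕ)) = ∑ y : Fin ℓ, ((w y : ℚ) : ℂ) * ζ ^ (y : ℕ) := by
  rw [map_sum]
  refine Finset.sum_congr rfl fun y _ => ?_
  rw [map_mul, aeval_C, map_pow, aeval_X, eq_ratCast]

/-- **A sum of `|P|` DISTINCT `ℓ`-th roots of unity with `0 < |P| < ℓ` is non-zero** (`ℓ` prime). [folklore] -/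
theorem sum_pow_ne_zero_of_card_lt {ζ : ℂ} (hζ : IsPrimitiveRoot ζ ℓ) (P : Finset (Fin ℓ)) (hP0 : P.Nonempty) (hPℓ : P.card < ℓ) :
    ∑ x ∈ P, ζ ^ (x : ℕ) ≠ 0 := by
  classical
  intro hsum
  -- the indicator polynomial of `P`
  set w : Fin ℓ → ℚ := fun y => if y ∈ P then 1 else 0 with hw
  have hroot : aeval ζ (∑ y : Fin ℓ, C (w y) * X ^ (y : ℕ)) = 0 := by
    rw [aeval_sum_C_mul_X_pow, ← hsum, ← Finset.sum_filter_add_sum_filter_not univ (fun y => y ∈ P)]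
    have h1 : (∑ y ∈ univ.filter (fun y => y ∈ P), ((w y : ℚ) : ℂ) * ζ ^ (y : ℕ)) = ∑ x ∈ P, ζ ^ (x : ℕ) := by
      rw [Finset.filter_mem_eq_inter, Finset.univ_inter]
      exact Finset.sum_congr rfl fun y hy => by rw [hw]; simp [hy]
    have h2 : (∑ y ∈ univ.filter (fun y => ¬ y ∈ P), ((w y : ℚ) : ℂ) * ζ ^ (y : ℕ)) = 0 :=
      Finset.sum_eq_zero fun y hy => by rw [hw]; simp [(Finset.mem_filter.1 hy).2]
    rw [h1, h2, add_zero]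
  have hG : ∀ i, ℓ ≤ i → (∑ y : Fin ℓ, C (w y) * X ^ (y : ℕ)).coeff i = 0 := fun i hi => by
    rw [coeff_sum_C_mul_X_pow, dif_neg (by omega)]
  have hconst := coeff_eq_of_aeval_eq_zero hζ hG hroot
  -- all indicator values are equal: `P = ∅` or `P = univ`
  obtain ⟨x₀, hx₀⟩ := hP0
  have hall : ∀ y : Fin ℓ, y ∈ P := by
    intro y
    have hy := hconst y y.2
    have hx := hconst x₀ x₀.2
    rw [coeff_sum_C_mul_X_pow, dif_pos y.2] at hy
    rw [coeff_sum_C_mul_X_pow, dif_pos x₀.2] at hx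
    have hwy : w y = w x₀ := by rw [Fin.eta] at hy hx; rw [hy, hx]
    rw [hw] at hwy
    simp only [hx₀, if_true] at hwy
    by_contra hyP
    rw [if_neg hyP] at hwy
    exact zero_ne_one hwy
  have hcard : P.card = ℓ := by
    rw [Finset.eq_univ_of_forall hall, Finset.card_univ, Fintype.card_fin]
  omega

omit hℓ in
/-- `ζ^{(x + j) mod ℓ} = ζ^x ζ^j` on `Fin ℓ`. [folklore] -/
theorem pow_val_add {ζ : ℂ} (hζ : IsPrimitiveRoot ζ ℓ) (x j : Fin ℓ) : ζ ^ ((x + j : Fin ℓ) : ℕ) = ζ ^ (x : ℕ) * ζ ^ (j : ℕ) := by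
  rw [Fin.val_add, ← pow_add]
  conv_rhs => rw [← Nat.mod_add_div ((x : ℕ) + j) ℓ]
  rw [pow_add, pow_mul, hζ.pow_eq_one, one_pow, mul_one]

/-- **PRIME ROTATIONS SEPARATE.**  `ℓ` prime, `P ⊆ ℤ/ℓ` with `0 < |P| < ℓ`, `u : ℤ/ℓ → ℤ`: if the translate sums `Σ_{x ∈ P} u(x + j)` do not depend on `j`, then `u` is
constant.  (For `ℓ = 5`, `|P| = 2` this is `SexticDecicWeil.const_of_pairSums`.) [cite: DixonMortimer1996, §2.1] -/
theorem const_of_translate_sums (P : Finset (Fin ℓ)) (hP0 : P.Nonempty) (hPℓ : P.card < ℓ) {u : Fin ℓ → ℤ}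
    (h : ∀ j : Fin ℓ, ∑ x ∈ P, u (x + j) = ∑ x ∈ P, u x) (a b : Fin ℓ) : u a = u b := by
  classical
  have hℓp : ℓ.Prime := hℓ.out
  haveI : NeZero ℓ := ⟨hℓp.ne_zero⟩
  set ζ : ℂ := Complex.exp (2 * Real.pi * Complex.I / ℓ) with hζdef
  have hζ : IsPrimitiveRoot ζ ℓ := Complex.isPrimitiveRoot_exp ℓ hℓp.ne_zero
  -- the complex sums
  set g : Fin ℓ → ℂ := fun y => ((u y : ℚ) : ℂ) with hg
  set A : ℂ := ∑ y : Fin ℓ, g y * ζ ^ (y : ℕ) with hA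
  have hS : ∀ j : Fin ℓ, (∑ x ∈ P, g (x + j)) = ∑ x ∈ P, g x := by
    intro j
    have h1 := congrArg (fun z : ℤ => ((z : ℚ) : ℂ)) (h j)
    simpa [hg] using h1
  -- `Σ_j S(j) ζ^j = 0`
  have hgeom : (∑ j : Fin ℓ, ζ ^ (j : ℕ)) = 0 := by
    rw [Fin.sum_univ_eq_sum_range (fun i => ζ ^ i) ℓ]
    exact hζ.geom_sum_eq_zero hℓp.one_lt
  have hT0 : (∑ j : Fin ℓ, (∑ x ∈ P, g (x + j)) * ζ ^ (j : ℕ)) = 0 := by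
    rw [Finset.sum_congr rfl fun j _ => by rw [hS j], ← Finset.mul_sum, hgeom, mul_zero]
  -- `Σ_j S(j) ζ^j = (Σ_{x ∈ P} ζ^{−x}) · A`
  have hreindex : ∀ x : Fin ℓ, (∑ j : Fin ℓ, g (x + j) * ζ ^ (j : ℕ)) = ζ ^ ((-x : Fin ℓ) : ℕ) * A := by
    intro x
    have h1 : (∑ j : Fin ℓ, g (x + j) * ζ ^ (j : ℕ)) = ∑ y : Fin ℓ, g y * ζ ^ ((y + -x : Fin ℓ) : ℕ) := by
      refine Fintype.sum_equiv (Equiv.addLeft x) _ _ fun j => ?_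
      show g (x + j) * ζ ^ (j : ℕ) = g (x + j) * ζ ^ ((x + j + -x : Fin ℓ) : ℕ)
      rw [add_neg_cancel_comm]
    rw [h1, hA, Finset.mul_sum]
    refine Finset.sum_congr rfl fun y _ => ?_
    rw [pow_val_add hζ]
    ring
  have hT : (∑ j : Fin ℓ, (∑ x ∈ P, g (x + j)) * ζ ^ (j : ℕ)) = (∑ x ∈ P, ζ ^ ((-x : Fin ℓ) : ℕ)) * A := by
    rw [Finset.sum_congr rfl fun j _ => Finset.sum_mul P (fun x => g (x + j)) (ζ ^ (j : ℕ)), Finset.sum_comm, Finset.sum_mul]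
    exact Finset.sum_congr rfl fun x _ => hreindex x
  -- the first factor is non-zero: a sum of `|P|` distinct roots of unity
  have hQ : (∑ x ∈ P, ζ ^ ((-x : Fin ℓ) : ℕ)) ≠ 0 := by
    rw [← Finset.sum_image (f := fun x' : Fin ℓ => ζ ^ (x' : ℕ)) (s := P) (g := fun x : Fin ℓ => -x) fun x _ x' _ hxx' => neg_injective hxx']
    refine sum_pow_ne_zero_of_card_lt hζ _ (hP0.image _) ?_
    rw [Finset.card_image_of_injective _ neg_injective]
    exact hPℓ
  have hA0 : A = 0 := by
    have h1 : (∑ x ∈ P, ζ ^ ((-x : Fin ℓ) : ℕ)) * A = 0 := by rw [← hT, hT0]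
    exact (mul_eq_zero.1 h1).resolve_left hQ
  -- hence `Σ_y u(y) X^y` vanishes at `ζ`: `u` is constant
  have hroot : aeval ζ (∑ y : Fin ℓ, C (u y : ℚ) * X ^ (y : ℕ)) = 0 := by rw [aeval_sum_C_mul_X_pow, ← hA0, hA]
  have hG : ∀ i, ℓ ≤ i → (∑ y : Fin ℓ, C (u y : ℚ) * X ^ (y : ℕ)).coeff i = 0 := fun i hi => by
    rw [coeff_sum_C_mul_X_pow, dif_neg (by omega)]
  have hconst := coeff_eq_of_aeval_eq_zero hζ hG hroot
  have ha := hconst a a.2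
  have hb := hconst b b.2
  rw [coeff_sum_C_mul_X_pow, dif_pos a.2, Fin.eta] at ha
  rw [coeff_sum_C_mul_X_pow, dif_pos b.2, Fin.eta] at hb
  exact_mod_cast ha.trans hb.symm

end Cyclotomic

end Summit.HodgeConjecture.CorCM.Census.MultiFieldWeil
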